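import Literature.Probability.LatticeModels.SixVertexSpectralTiltMeasure
import Literature.Probability.LatticeModels.SixVertexGFFSpectralMeasure
import Literature.MeasureTheory.Integral.LaplaceTransformUnique

/-!
# Six-vertex spectral measures: `Ψ_μ` determines `μ` (DKLM 2026, Part II §1.1, the "simple exercise")

H. Duminil-Copin, K. K. Kozlowski, P. Lammers, I. Manolescu, *Gaussian free field convergence of
the six-vertex model with `-1 ≤ Δ ≤ -1/2`*, arXiv:2603.06268 (2026) [DKLM2026SixVertexGFF]
(`paper:arxiv-2603.06268`, chunks p0022, p0036):

> it is a simple exercise (see also the proof of Theorem (thm:main measure)) to check from the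
> expression above that `Ψ₂ = σ²·Ψ₂^GFF` for some `σ > 0` if and only if `μ[{b² ≠ a²}] = 0` and the
> density of the first marginal of `μ` is `σ²/(2πa) da`.

This file proves the **"only if" direction** for measures in the space `𝓜_{c,C}` of
Definition 29 (where all subsequential limits of the `μ_L` live, Lemma 31 (i)), in the strong form
**`Ψ_μ` determines `μ`**:

1. `dklmF_eq_of_dklmPsi_eq` — *`Ψ` determines `F`*: if `Ψ_μ = Ψ_ν` on the configurations of two
   HORIZONTAL pairs `(m+1, 0, x₁', y₁', x₂, 0)` (first pair of integer length `m+1`, vertical offset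
   `y₁'`, `x₁', x₂ > 0`), then `F_μ = F_ν` on `(0,∞) × ℝ` (Lemma 37 (i): the `ε`-derivative of `Ψ`
   is a difference of two values of `F`; Lemma 37 (iv)–(v): `F(x,y) → 0` as `x → ∞`);
2. `eq_of_dklmF_eq` — *`F` determines `μ`*: `y ↦ F(x,-y)` is the characteristic function of the
   finite measure `(a e^{-ax} μ) ∘ snd⁻¹` (`SixVertexSpectralTiltMeasure.lean`), so these
   `b`-marginals agree (`Measure.ext_of_charFun`);
   then for every Borel `B ⊆ ℝ`, `x ↦ (a e^{-ax}μ)(ℝ × B)` is the Laplace transform of the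
   `a`-marginal of `a 𝟙_B(b) μ`, so these agree
   (`Literature.MeasureTheory.Integral.ext_of_forall_lintegral_exp_neg_nat_mul_eq`); hence `a μ`
   and `a ν` agree on rectangles, hence everywhere, and `μ = ν`;
3. `eq_of_dklmPsi_eq`, **`eq_gffSpectralMeasure_of_dklmPsi_eq_gff`** — `Ψ_μ = Ψ_ν ⇒ μ = ν`, and
   `Ψ_μ = σ² Ψ₂^GFF ⇒ μ = μ_σ = ½(δ_{b=a}+δ_{b=-a}) ⊗ σ²/(2πa) da` (with
   `integral_chiCont_gffSpectralMeasure`, the "if" direction).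

In particular Theorem 53 follows from the convergence `Φ₂^{(δ)} → σ² Ψ₂^GFF` and Lemma 34
(`Ψ₂ = Ψ_μ` along convergence sequences) without the detour through Theorems 40 and 46.

## References

* H. Duminil-Copin, K. K. Kozlowski, P. Lammers, I. Manolescu, arXiv:2603.06268 (2026), Part II,
  §1.1 (the "simple exercise"), Lemma 37, Theorem 53. [DKLM2026SixVertexGFF]
-/

noncomputable section

open MeasureTheory Set Filter Topology Complex
open scoped ENNReal
open Literature.MeasureTheory.Integral

namespace Literature.Probability.LatticeModels.SixVertex

variable {c C c' C' : ℝ} {μ ν : Measure (ℝ × ℝ)}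

/-! ## 1. `Ψ` determines `F` -/

/-- **The `ε`-derivatives agree**: `F_μ(m+1+x₁', y₁') - F_μ(x₁',y₁') = F_ν(m+1+x₁', y₁') - F_ν(x₁',y₁')`
whenever `Ψ_μ = Ψ_ν` on the configurations `(m+1, 0, x₁', y₁', ε, 0)`, `ε > 0` — two HORIZONTAL
pairs, the first of integer length `m + 1` (Lemma 37 (i) at `y₁ = 0`).
[cite: DKLM2026SixVertexGFF, Part II, Lemma 37 (i)] -/
theorem dklmF_sub_eq_of_dklmPsi_eq (hμ : μ ∈ dklmSpaceM c C) (hν : ν ∈ dklmSpaceM c' C')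
    (hΨ : ∀ (m : ℕ) (x₁' y₁' x₂ : ℝ), 0 < x₁' → 0 < x₂ →
      dklmPsi μ (m + 1) 0 x₁' y₁' x₂ 0 = dklmPsi ν (m + 1) 0 x₁' y₁' x₂ 0)
    (m : ℕ) {x₁' : ℝ} (hx₁' : 0 < x₁') (y₁' : ℝ) :
    dklmF μ ((((m : ℝ) + 1) + x₁' : ℝ) : ℂ) (0 + y₁') - dklmF μ (x₁' : ℂ) y₁' =
      dklmF ν ((((m : ℝ) + 1) + x₁' : ℝ) : ℂ) (0 + y₁') - dklmF ν (x₁' : ℂ) y₁' := by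
  have hx₁ : (0 : ℝ) ≤ (m : ℝ) + 1 := by positivity
  refine tendsto_nhds_unique_of_eventuallyEq (tendsto_dklmPsi_div hμ hx₁ hx₁' 0 y₁')
    (tendsto_dklmPsi_div hν hx₁ hx₁' 0 y₁') ?_
  filter_upwards [self_mem_nhdsWithin] with ε (hε : 0 < ε)
  rw [hΨ m x₁' y₁' ε hx₁' hε]

/-- `F(x + n, y) → 0` as `n → ∞` (Lemma 37 (iv)–(v)). [cite: DKLM2026SixVertexGFF, Part II, Lemma 37 (iv)–(v)] -/
theorem tendsto_dklmF_add_nat (hμ : μ ∈ dklmSpaceM c C) (x y : ℝ) :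
    Tendsto (fun n : ℕ => dklmF μ (((n : ℝ) + x : ℝ) : ℂ) y) atTop (𝓝 0) := by
  rw [tendsto_zero_iff_norm_tendsto_zero]
  have hlim : Tendsto (fun n : ℕ => (dklmF μ ((((n : ℝ) + x : ℝ) : ℂ)) 0).re) atTop (𝓝 0) := by
    have h1 := (tendsto_dklmF_atTop hμ).comp (tendsto_atTop_add_const_right atTop x tendsto_natCast_atTop_atTop)
    have h2 := (Complex.continuous_re.tendsto 0).comp h1
    rw [Complex.zero_re] at h2
    exact h2
  refine squeeze_zero (fun n => norm_nonneg _) (fun n => ?_) hlim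
  have := norm_dklmF_le hμ ((((n : ℝ) + x : ℝ) : ℂ)) y
  rwa [Complex.ofReal_re] at this

/-- **`Ψ` determines `F`**: for `μ, ν ∈ 𝓜`, if `Ψ_μ = Ψ_ν` on the configurations of two
horizontal pairs `(m+1, 0, x₁', y₁', x₂, 0)` (`m ∈ ℕ`, `x₁', x₂ > 0`, `y₁' ∈ ℝ`), then `F_μ = F_ν` on
`(0,∞) × ℝ`. [cite: DKLM2026SixVertexGFF, Part II §1.1 and Lemma 37] -/
theorem dklmF_eq_of_dklmPsi_eq (hμ : μ ∈ dklmSpaceM c C) (hν : ν ∈ dklmSpaceM c' C')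
    (hΨ : ∀ (m : ℕ) (x₁' y₁' x₂ : ℝ), 0 < x₁' → 0 < x₂ →
      dklmPsi μ (m + 1) 0 x₁' y₁' x₂ 0 = dklmPsi ν (m + 1) 0 x₁' y₁' x₂ 0)
    {x : ℝ} (hx : 0 < x) (y : ℝ) : dklmF μ x y = dklmF ν x y := by
  -- `F_μ(x,y) - F_ν(x,y) = F_μ(m+1+x,y) - F_ν(m+1+x,y) → 0`
  have hconst : ∀ m : ℕ, dklmF μ x y - dklmF ν x y =
      dklmF μ (((((m + 1 : ℕ) : ℝ)) + x : ℝ) : ℂ) (0 + y) - dklmF ν (((((m + 1 : ℕ) : ℝ)) + x : ℝ) : ℂ) (0 + y) := by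
    intro m
    have h := dklmF_sub_eq_of_dklmPsi_eq hμ hν hΨ m hx y
    push_cast at h ⊢
    linear_combination (-1 : ℂ) * h
  have hlim : Tendsto (fun m : ℕ => dklmF μ (((((m + 1 : ℕ) : ℝ)) + x : ℝ) : ℂ) (0 + y) -
      dklmF ν (((((m + 1 : ℕ) : ℝ)) + x : ℝ) : ℂ) (0 + y)) atTop (𝓝 (0 - 0)) := by
    rw [zero_add]
    exact ((tendsto_dklmF_add_nat hμ x y).comp (tendsto_add_atTop_nat 1)).sub
      ((tendsto_dklmF_add_nat hν x y).comp (tendsto_add_atTop_nat 1))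
  rw [sub_zero] at hlim
  have : dklmF μ x y - dklmF ν x y = 0 :=
    tendsto_nhds_unique (tendsto_const_nhds.congr fun m => hconst m) hlim
  exact sub_eq_zero.1 this

/-! ## 2. `F` determines `μ` -/

/-- Equal `F`-functions give equal `b`-marginals of the tilted measures (`Measure.ext_of_charFun`).
[cite: DKLM2026SixVertexGFF, Part II §1.1] -/
theorem map_snd_tiltMeasure_eq_of_dklmF_eq (hμ : μ ∈ dklmSpaceM c C) (hν : ν ∈ dklmSpaceM c' C')
    (hF : ∀ x : ℝ, 0 < x → ∀ y : ℝ, dklmF μ x y = dklmF ν x y) {x : ℝ} (hx : 0 < x) :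
    (tiltMeasure μ x).map Prod.snd = (tiltMeasure ν x).map Prod.snd := by
  haveI := isFiniteMeasure_tiltMeasure hμ hx
  haveI := isFiniteMeasure_tiltMeasure hν hx
  refine Measure.ext_of_charFun (funext fun t => ?_)
  rw [charFun_map_snd_tiltMeasure hμ x, charFun_map_snd_tiltMeasure hν x, hF x hx]

/-- The tilted mass of a horizontal strip `ℝ × B` is the `b`-marginal mass of `B`. [folklore] -/
theorem tiltMeasure_univ_prod (μ : Measure (ℝ × ℝ)) (x : ℝ) {B : Set ℝ} (hB : MeasurableSet B) :
    tiltMeasure μ x (univ ×ˢ B) = (tiltMeasure μ x).map Prod.snd B := by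
  rw [Measure.map_apply measurable_snd hB, univ_prod]

/-- The `a`-marginal of the tilted measure `a e^{-a} μ` restricted to the strip `ℝ × B`. [folklore] -/
def stripMarginal (μ : Measure (ℝ × ℝ)) (B : Set ℝ) : Measure ℝ :=
  ((tiltMeasure μ 1).restrict (univ ×ˢ B)).map Prod.fst

/-- The Laplace transform of the strip marginal at `s` is the `(1+s)`-tilted mass of the strip.
[cite: DKLM2026SixVertexGFF, Part II, proof of Theorem 53] -/
theorem lintegral_exp_neg_stripMarginal (μ : Measure (ℝ × ℝ)) {B : Set ℝ} (hB : MeasurableSet B) (s : ℝ) :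
    ∫⁻ a, ENNReal.ofReal (Real.exp (-(s * a))) ∂stripMarginal μ B = tiltMeasure μ (1 + s) (univ ×ˢ B) := by
  have hmeas : Measurable fun a : ℝ => ENNReal.ofReal (Real.exp (-(s * a))) :=
    (Real.measurable_exp.comp (measurable_id.const_mul s).neg).ennreal_ofReal
  have hmeas2 : Measurable fun p : ℝ × ℝ => ENNReal.ofReal (Real.exp (-(s * p.1))) := hmeas.comp measurable_fst
  have hstrip : MeasurableSet (univ ×ˢ B : Set (ℝ × ℝ)) := MeasurableSet.univ.prod hB
  rw [stripMarginal, lintegral_map hmeas measurable_fst, tiltMeasure, tiltMeasure,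
    setLIntegral_withDensity_eq_setLIntegral_mul _ (measurable_tiltDensity 1) hmeas2 hstrip,
    withDensity_apply _ hstrip]
  refine setLIntegral_congr_fun hstrip fun p _ => ?_
  simp only [Pi.mul_apply, tiltDensity]
  have hs' : 0 ≤ Real.exp (-(s * p.1)) := Real.exp_nonneg _
  rw [mul_comm (ENNReal.ofReal _), ← ENNReal.ofReal_mul hs']
  congr 1
  rw [mul_comm (Real.exp _), mul_assoc, ← Real.exp_add]
  congr 2
  ring

/-- The strip marginal gives no mass to `{a < 0}` (the density `a e^{-a}` vanishes there). [folklore] -/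
theorem stripMarginal_Iio (μ : Measure (ℝ × ℝ)) (B : Set ℝ) : stripMarginal μ B (Iio 0) = 0 := by
  have hm : MeasurableSet (Prod.fst ⁻¹' Iio (0 : ℝ) : Set (ℝ × ℝ)) := measurableSet_Iio.preimage measurable_fst
  rw [stripMarginal, Measure.map_apply measurable_fst measurableSet_Iio]
  refine le_antisymm ((Measure.restrict_apply_le _ _).trans (le_of_eq ?_)) bot_le
  rw [tiltMeasure, withDensity_apply _ hm]
  refine (setLIntegral_congr_fun hm fun p (hp : p.1 < 0) => ?_).trans lintegral_zero
  rw [tiltDensity, ENNReal.ofReal_of_nonpos]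
  nlinarith [Real.exp_pos (-(p.1 * 1))]

/-- **Laplace uniqueness**: equal `F`-functions give equal strip marginals.
[cite: DKLM2026SixVertexGFF, Part II, proof of Theorem 53 ("a σ-finite positive measure is uniquely determined by its Laplace transform")] -/
theorem stripMarginal_eq_of_dklmF_eq (hμ : μ ∈ dklmSpaceM c C) (hν : ν ∈ dklmSpaceM c' C')
    (hF : ∀ x : ℝ, 0 < x → ∀ y : ℝ, dklmF μ x y = dklmF ν x y) {B : Set ℝ} (hB : MeasurableSet B) :
    stripMarginal μ B = stripMarginal ν B := by
  -- the Laplace transforms at `s = n + 1`, `n ∈ ℕ`, and finiteness at `s = 1`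
  have hL : ∀ (ρ : Measure (ℝ × ℝ)) (s : ℝ),
      ∫⁻ a, ENNReal.ofReal (Real.exp (-(s * a))) ∂stripMarginal ρ B = (tiltMeasure ρ (1 + s)).map Prod.snd B := by
    intro ρ s
    rw [lintegral_exp_neg_stripMarginal ρ hB s, tiltMeasure_univ_prod ρ _ hB]
  have hfin : ∀ ρ : Measure (ℝ × ℝ), ρ ∈ dklmSpaceM c C ∨ ρ ∈ dklmSpaceM c' C' →
      ∫⁻ a, ENNReal.ofReal (Real.exp (-a)) ∂stripMarginal ρ B ≠ ⊤ := by
    intro ρ hρ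
    have h1 := hL ρ 1
    simp only [one_mul] at h1
    rw [h1]
    have : IsFiniteMeasure (tiltMeasure ρ (1 + 1)) := by
      rcases hρ with h | h
      · exact isFiniteMeasure_tiltMeasure h (by norm_num)
      · exact isFiniteMeasure_tiltMeasure h (by norm_num)
    exact (measure_lt_top _ _).ne
  refine ext_of_forall_lintegral_exp_neg_nat_mul_eq (stripMarginal_Iio μ B) (stripMarginal_Iio ν B)
    (hfin μ (Or.inl hμ)) (hfin ν (Or.inr hν)) fun n => ?_
  rw [hL μ, hL ν, map_snd_tiltMeasure_eq_of_dklmF_eq hμ hν hF (by positivity)]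

/-- The tilted mass of a measurable rectangle is a value of the strip marginal. [folklore] -/
theorem tiltMeasure_prod_eq_stripMarginal (μ : Measure (ℝ × ℝ)) {A : Set ℝ} (hA : MeasurableSet A) (B : Set ℝ) :
    tiltMeasure μ 1 (A ×ˢ B) = stripMarginal μ B A := by
  rw [stripMarginal, Measure.map_apply measurable_fst hA, Measure.restrict_apply (hA.preimage measurable_fst)]
  congr 1
  ext p
  simp only [mem_inter_iff, mem_preimage, mem_prod, mem_univ, true_and]

/-- **The tilted measures agree**: `a e^{-a} μ = a e^{-a} ν` (a finite measure is determined by its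
values on the `π`-system of measurable rectangles). [cite: DKLM2026SixVertexGFF, Part II §1.1] -/
theorem tiltMeasure_one_eq_of_dklmF_eq (hμ : μ ∈ dklmSpaceM c C) (hν : ν ∈ dklmSpaceM c' C')
    (hF : ∀ x : ℝ, 0 < x → ∀ y : ℝ, dklmF μ x y = dklmF ν x y) : tiltMeasure μ 1 = tiltMeasure ν 1 := by
  haveI := isFiniteMeasure_tiltMeasure hμ one_pos
  have hrect : ∀ A B : Set ℝ, MeasurableSet A → MeasurableSet B →
      tiltMeasure μ 1 (A ×ˢ B) = tiltMeasure ν 1 (A ×ˢ B) := by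
    intro A B hA hB
    rw [tiltMeasure_prod_eq_stripMarginal μ hA B, tiltMeasure_prod_eq_stripMarginal ν hA B,
      stripMarginal_eq_of_dklmF_eq hμ hν hF hB]
  refine ext_of_generate_finite _ generateFrom_prod.symm isPiSystem_prod ?_ ?_
  · rintro _ ⟨A, hA, B, hB, rfl⟩
    exact hrect A B hA hB
  · rw [← univ_prod_univ]
    exact hrect _ _ MeasurableSet.univ MeasurableSet.univ

/-- **`F` determines `μ`**: two measures in `𝓜` with the same function `F` on `(0,∞) × ℝ` are equal.
[cite: DKLM2026SixVertexGFF, Part II §1.1 (the "simple exercise") and proof of Theorem 53] -/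
theorem eq_of_dklmF_eq (hμ : μ ∈ dklmSpaceM c C) (hν : ν ∈ dklmSpaceM c' C')
    (hF : ∀ x : ℝ, 0 < x → ∀ y : ℝ, dklmF μ x y = dklmF ν x y) : μ = ν := by
  rw [← withDensity_inv_tiltMeasure hμ, ← withDensity_inv_tiltMeasure hν,
    tiltMeasure_one_eq_of_dklmF_eq hμ hν hF]

/-! ## 3. `Ψ` determines `μ`; the GFF case -/

/-- **`Ψ` determines `μ`**: two measures in `𝓜` with the same two-point function `Ψ` on the
configurations of two horizontal pairs `(m+1, 0, x₁', y₁', x₂, 0)` are equal.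
[cite: DKLM2026SixVertexGFF, Part II §1.1 (the "simple exercise")] -/
theorem eq_of_dklmPsi_eq (hμ : μ ∈ dklmSpaceM c C) (hν : ν ∈ dklmSpaceM c' C')
    (hΨ : ∀ (m : ℕ) (x₁' y₁' x₂ : ℝ), 0 < x₁' → 0 < x₂ →
      dklmPsi μ (m + 1) 0 x₁' y₁' x₂ 0 = dklmPsi ν (m + 1) 0 x₁' y₁' x₂ 0) : μ = ν :=
  eq_of_dklmF_eq hμ hν fun _ hx y => dklmF_eq_of_dklmPsi_eq hμ hν hΨ hx y

/-- The configuration `(u₁,u₁',u₂,u₂')` with `u₁ = 0` and increments `u₁'-u₁ = x₁+iy₁`,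
`u₂-u₁' = x₁'+iy₁'`, `u₂'-u₂ = x₂+iy₂` (eq. (definition xiyietc via uiuprimei)).
[cite: DKLM2026SixVertexGFF, Part II §1.1] -/
def configOf (x₁ y₁ x₁' y₁' x₂ y₂ : ℝ) : Fin 2 → ℂ × ℂ :=
  ![((0 : ℂ), (⟨x₁, y₁⟩ : ℂ)), ((⟨x₁ + x₁', y₁ + y₁'⟩ : ℂ), (⟨x₁ + x₁' + x₂, y₁ + y₁' + y₂⟩ : ℂ))]

/-- **The "if" direction**: `Ψ_{μ_σ} = σ² Ψ₂^GFF` on the horizontally ordered configurations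
(`integral_chiCont_gffSpectralMeasure` in coordinates). [cite: DKLM2026SixVertexGFF, Part II §1.1] -/
theorem dklmPsi_gffSpectralMeasure (σ : ℝ) {x₁ x₁' x₂ : ℝ} (hx₁ : 0 ≤ x₁) (hx₁' : 0 < x₁') (hx₂ : 0 ≤ x₂)
    (y₁ y₁' y₂ : ℝ) :
    dklmPsi (gffSpectralMeasure σ) x₁ y₁ x₁' y₁' x₂ y₂ =
      ((σ ^ 2 * gffKPoint 2 (configOf x₁ y₁ x₁' y₁' x₂ y₂) : ℝ) : ℂ) := by
  have h := integral_chiCont_gffSpectralMeasure σ (configOf x₁ y₁ x₁' y₁' x₂ y₂)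
  simp only [configOf, Matrix.cons_val_zero, Matrix.cons_val_one, Complex.sub_re, Complex.sub_im, sub_zero,
    add_sub_cancel_left] at h
  exact h hx₁ hx₁' hx₂

/-- **The "only if" direction of the simple exercise, strong form**: a measure `μ ∈ 𝓜` whose
two-point function is `σ² Ψ₂^GFF` on the configurations of two horizontal pairs
`(m+1, 0, x₁', y₁', x₂, 0)` **is** the GFF spectral measure `μ_σ = ½(δ_{b=a} + δ_{b=-a}) ⊗ σ²/(2πa) 𝟙_{a>0} da`; in
particular `μ{b² ≠ a²} = 0` and the first marginal of `μ` has density `σ²/(2πa)`.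
[cite: DKLM2026SixVertexGFF, Part II §1.1 (the "simple exercise"), Theorem 53] -/
theorem eq_gffSpectralMeasure_of_dklmPsi_eq (hμ : μ ∈ dklmSpaceM c C) (σ : ℝ)
    (hΨ : ∀ (m : ℕ) (x₁' y₁' x₂ : ℝ), 0 < x₁' → 0 < x₂ →
      dklmPsi μ (m + 1) 0 x₁' y₁' x₂ 0 = ((σ ^ 2 * gffKPoint 2 (configOf (m + 1) 0 x₁' y₁' x₂ 0) : ℝ) : ℂ)) :
    μ = gffSpectralMeasure σ :=
  eq_of_dklmPsi_eq hμ (gffSpectralMeasure_mem_dklmSpaceM σ c) fun m x₁' y₁' x₂ hx₁' hx₂ => by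
    rw [hΨ m x₁' y₁' x₂ hx₁' hx₂, dklmPsi_gffSpectralMeasure σ (by positivity) hx₁' hx₂.le]

/-- The first marginal of `μ_σ` is `σ²/(2πa) 𝟙_{a>0} da`. [cite: DKLM2026SixVertexGFF, Theorem 53] -/
theorem map_fst_gffSpectralMeasure (σ : ℝ) : (gffSpectralMeasure σ).map Prod.fst = gffRadial σ := by
  rw [gffSpectralMeasure, Measure.map_smul, Measure.map_add _ _ measurable_fst,
    Measure.map_map measurable_fst measurable_diagEmb, Measure.map_map measurable_fst measurable_adiagEmb]
  have h1 : Prod.fst ∘ diagEmb = id := rfl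
  have h2 : Prod.fst ∘ adiagEmb = id := rfl
  rw [h1, h2, Measure.map_id, ← two_smul ℝ≥0∞, smul_smul, ENNReal.inv_mul_cancel (by norm_num) (by norm_num),
    one_smul]

/-- `μ_σ` is concentrated on `{b² = a²}`. [cite: DKLM2026SixVertexGFF, Theorem 53] -/
theorem gffSpectralMeasure_sq_ne_sq (σ : ℝ) : gffSpectralMeasure σ {p : ℝ × ℝ | p.2 ^ 2 ≠ p.1 ^ 2} = 0 := by
  have hm : MeasurableSet {p : ℝ × ℝ | p.2 ^ 2 ≠ p.1 ^ 2} :=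
    (measurableSet_eq_fun (measurable_snd.pow_const 2) (measurable_fst.pow_const 2)).compl
  rw [gffSpectralMeasure_apply σ hm]
  have h1 : diagEmb ⁻¹' {p : ℝ × ℝ | p.2 ^ 2 ≠ p.1 ^ 2} = ∅ := by
    ext a; simp [diagEmb]
  have h2 : adiagEmb ⁻¹' {p : ℝ × ℝ | p.2 ^ 2 ≠ p.1 ^ 2} = ∅ := by
    ext a; simp [adiagEmb]
  rw [h1, h2, measure_empty, add_zero, mul_zero]

/-- **The simple exercise as printed ("only if")**: if `Ψ_μ = σ² Ψ₂^GFF` for `μ ∈ 𝓜`, then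
`μ{b² ≠ a²} = 0` and the first marginal of `μ` is `σ²/(2πa) 𝟙_{a>0} da`.
[cite: DKLM2026SixVertexGFF, Part II §1.1 (the "simple exercise")] -/
theorem concentrated_and_marginal_of_dklmPsi_eq (hμ : μ ∈ dklmSpaceM c C) (σ : ℝ)
    (hΨ : ∀ (m : ℕ) (x₁' y₁' x₂ : ℝ), 0 < x₁' → 0 < x₂ →
      dklmPsi μ (m + 1) 0 x₁' y₁' x₂ 0 = ((σ ^ 2 * gffKPoint 2 (configOf (m + 1) 0 x₁' y₁' x₂ 0) : ℝ) : ℂ)) :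
    μ {p : ℝ × ℝ | p.2 ^ 2 ≠ p.1 ^ 2} = 0 ∧ μ.map Prod.fst = gffRadial σ := by
  rw [eq_gffSpectralMeasure_of_dklmPsi_eq hμ σ hΨ]
  exact ⟨gffSpectralMeasure_sq_ne_sq σ, map_fst_gffSpectralMeasure σ⟩

end Literature.Probability.LatticeModels.SixVertex

end
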